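import Summits.HubbardSuperconductivity.HubbardSuperconductivity.Theses.LogColdTorus
import Summits.HubbardSuperconductivity.HubbardSuperconductivity.Theorems.LogColdTorusAverageToEveryStubBlockAverageWitness
import Summits.HubbardSuperconductivity.HubbardSuperconductivity.Theorems.JosephsonMirrorJmCuspHalfFilledSimple
import Summits.HubbardSuperconductivity.HubbardSuperconductivity.Theorems.BalabanIRBirEveryGroundState
import HarnessLib

/-!
# Route `LogColdTorus`, crux `AverageToEvery` (item `stmt-HubbardSuperconductivity-10519`, shared with route
`AbelianDuality`): the HALF-FILLED slice of the crux is a theorem (Lieb's Theorem 2)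

Helpers (`--supports`) for the crux
`Summit.HubbardSuperconductivity.HubbardSuperconductivity.Theses.LogColdTorus.AverageToEvery` — a
calibration of the BET of line `birth` (`Cruxes/AverageToEvery/Lines/birth.lean`, stub
`stub_countableAccidentalCouplings`) on the one filling of its range that is accessible to theorems.

The crux is a law for EVERY real `δ` (filling `N_L = 2⌊(1-δ)L²/2⌋`). At `δ = 0` (half filling,
`N_L = L²` on even tori) the repulsive Hubbard torus has a UNIQUE `(L², S^z = 0)`-sector ground state
for every `U > 0` and every even side (Lieb's Theorem 2 on the connected bipartite even torus with
equinumerous sublattices, in tree: `JosephsonMirror.szSector_groundStates_smul_of_liebTwo`), so the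
"average ⇒ every" upgrade is EMPTY there:

* `groundStates_smul_halfFilling` — any two `(L², S^z = 0)`-sector ground states of
  `hubbardTorus 2 L 1 U`, `U > 0`, even `L`, are proportional (Lieb 2, every even side, no threshold);
* `irreducibleGround_halfFilling` — hence the sector ground eigenspace `E₀(U, L)` at `δ = 0` has no
  subspace other than `⊥` and itself AT ALL (a fortiori none invariant under the joint commutant):
  the hypothesis-free irreducible-ground law behind `averageToEvery_of_irreducibleGroundLaw` HOLDS at
  `δ = 0`, at EVERY coupling `U > 0` (no exceptional set, no window);
* `stub_countableAccidentalCouplings_halfFilling` — the registered BET of line `birth` with `δ := 0`,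
  verbatim, with `L₁ = 0` and EMPTY exceptional sets `B L = ∅`;
* `averageToEvery_pointwise_halfFilling` — at `δ = 0` the every-ground-state upgrade holds POINTWISE
  in the coupling: at any single `U > 0`, an eventual block ground-state average `≥ c L⁴` of
  `Δ_d† Δ_d` forces `d_{x²-y²}` pair-field long-range order of EVERY admissible ground-state sequence
  at that `U` (block ↔ Fock dictionary `stub_blockAverageWitness` + uniqueness + the landed
  `hasLRO_of_forall_groundState_bound`);
* `averageToEvery_halfFilling` — the crux `AverageToEvery` with `δ := 0`, verbatim (window form);
* `averageToEvery_imp_halfFilling` — bookkeeping: the previous statement IS the `δ = 0` instance of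
  the crux (one-term specialisation; certifies the slice is typed exactly as the crux).

Calibration of the BET on its whole `δ`-range (for the planner): TRUE at `δ = 0` for every `U > 0`
(this file); trivially true for `|δ| ≥ 1` (empty or one-dimensional sectors, vacuous hypothesis);
OPEN exactly on the doped range `0 < |δ| < 1` — which contains the summit's `δ ∈ (0, 1/2)` — where it
is the Hubbard-specific spectral-rigidity residual recorded in
`Cruxes/AverageToEvery/PROMOTE-stub_countableAccidentalCouplings.md`. (Physically the `δ = 0`
instance is expected to be vacuous — no d-wave pair order in the half-filled repulsive model — but
that is not a theorem either; the slice proved here is unconditional.)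

Sources: E. H. Lieb, *Two theorems on the Hubbard model*, Phys. Rev. Lett. 62 (1989) 1201,
Theorem 2 (proved in tree: `LiebTwo.lieb_repulsive_halfFilling_core`); H. Tasaki, *Physics and
Mathematics of Quantum Many-Body Systems* (2020) §2.1, §9.3. No definition and no named fact is
introduced; everything is over existing declarations.
-/

noncomputable section

-- `dupNamespace`: the summit and the problem are both named `HubbardSuperconductivity` (layout D-0022)
set_option linter.dupNamespace false

namespace Summit.HubbardSuperconductivity.HubbardSuperconductivity.Theorems

open Matrix Finset Filter
open Literature.Probability.LatticeModels Literature.MathematicalPhysics.QuantumLattice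
open scoped ComplexOrder Matrix Classical

/-- **Lieb's Theorem 2 on every even torus, in sector language.** For `U > 0` and every even side
`L ≥ 1`, any two ground states of `hubbardTorus 2 L 1 U` in the joint sector `(L², S^z = 0)` — the
sector `(2⌊(1-δ)L²/2⌋, S^z = 0)` of the crux at `δ = 0` — are proportional: the even torus graph is
connected (`fermionTorusGraph_connected`) and bipartite (`torusStagger_eq_neg_of_adj_holds`) with
equinumerous sublattices (`JosephsonMirror.two_mul_card_filter_torusStagger_eq_one`), so
`JosephsonMirror.szSector_groundStates_smul_of_liebTwo` applies. (Same proof as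
`JosephsonMirror.eventualSimplicity_halfFilling`, stated for every even side instead of eventually.)
Lieb, PRL 62 (1989) 1201, Theorem 2. [cite: LiebPRL1989, Theorem 2] -/
theorem groundStates_smul_halfFilling {U : ℝ} (hU : 0 < U) (L : ℕ) [NeZero L] (hLe : Even L)
    (φ φ' : Fock (Orb (FermionTorus 2 L)))
    (hφ : IsGroundStateInSector (hubbardTorus 2 L 1 U) (2 * ⌊(1 - 0) * (L : ℝ) ^ 2 / 2⌋₊) 0 φ)
    (hφ' : IsGroundStateInSector (hubbardTorus 2 L 1 U) (2 * ⌊(1 - 0) * (L : ℝ) ^ 2 / 2⌋₊) 0 φ') :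
    ∃ a : ℂ, φ' = a • φ := by
  obtain ⟨m, hm⟩ := hLe
  set n : ℕ := 2 * m ^ 2 with hn
  have hfloor : ⌊(1 - 0) * (L : ℝ) ^ 2 / 2⌋₊ = n := by
    have h : (1 - 0) * (L : ℝ) ^ 2 / 2 = ((n : ℕ) : ℝ) := by
      rw [hn, hm]; push_cast; ring
    rw [h, Nat.floor_natCast]
  rw [hfloor] at hφ hφ'
  have hcard : Fintype.card (FermionTorus 2 L) = 2 * n := by
    rw [hn, hm]
    simp only [FermionTorus, Fintype.card_lex, Fintype.card_fun, Fintype.card_fin]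
    ring
  -- the bipartition by the staggering sign
  set A : Finset (FermionTorus 2 L) := univ.filter fun x : FermionTorus 2 L => torusStagger x = 1
    with hA
  have hmemA : ∀ x, x ∈ A ↔ torusStagger x = 1 := fun x => by
    rw [hA, mem_filter]
    exact ⟨fun h => h.2, fun h => ⟨mem_univ _, h⟩⟩
  have hAadj : ∀ x y : FermionTorus 2 L, (fermionTorusGraph 2 L).Adj x y → (x ∈ A ↔ y ∉ A) := by
    intro x y hxy
    have h := torusStagger_eq_neg_of_adj_holds ⟨m, hm⟩ hxy
    rw [hmemA, hmemA, h]
    change -torusStagger y = 1 ↔ torusStagger y ≠ 1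
    rw [Int.units_ne_iff_eq_neg, neg_eq_iff_eq_neg]
  have hAc : A.card + 0 = n := by
    have h := JosephsonMirror.two_mul_card_filter_torusStagger_eq_one (L := L) ⟨m, hm⟩
    rw [← hA] at h
    have hL2 : L ^ 2 = 2 * n := by rw [hn, hm]; ring
    omega
  exact JosephsonMirror.szSector_groundStates_smul_of_liebTwo (fermionTorusGraph 2 L)
    (fermionTorusGraph_connected 2 L) A hAadj hcard hAc one_ne_zero hU φ φ' hφ hφ'

/-- **The irreducible-ground law HOLDS at half filling, at every repulsive coupling.** For `U > 0`
and every even side `L ≥ 1`, the `(L², S^z = 0)`-sector ground eigenspace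
`E₀(U, L) = szSector N_L 0 ⊓ ker (H - e₀)` of `H = hubbardTorus 2 L 1 U` (`N_L = 2⌊(1-0)L²/2⌋`,
`e₀ = minEnergyOn H (szSector N_L 0)`) has no subspace other than `⊥` and itself: its nonzero members
are sector ground states, any two of which are proportional (`groundStates_smul_halfFilling`). In
particular it is irreducible under any family of operators whatsoever — the `δ = 0` case of the
hypothesis of `averageToEvery_of_irreducibleGroundLaw`, with no exceptional coupling.
Lieb, PRL 62 (1989) 1201, Theorem 2. [cite: LiebPRL1989, Theorem 2] -/
theorem irreducibleGround_halfFilling {U : ℝ} (hU : 0 < U) (L : ℕ) [NeZero L] (hLe : Even L)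
    (K' : Submodule ℂ (Fock (Orb (FermionTorus 2 L))))
    (hK' : K' ≤ szSector (2 * ⌊(1 - 0) * (L : ℝ) ^ 2 / 2⌋₊) 0 ⊓
        Module.End.eigenspace (Matrix.toLin' (hubbardTorus 2 L 1 U))
          ((((hubbardTorus 2 L 1 U).minEnergyOn
            (szSector (2 * ⌊(1 - 0) * (L : ℝ) ^ 2 / 2⌋₊) 0) : ℝ) : ℂ))) :
    K' = ⊥ ∨
      K' = szSector (2 * ⌊(1 - 0) * (L : ℝ) ^ 2 / 2⌋₊) 0 ⊓
        Module.End.eigenspace (Matrix.toLin' (hubbardTorus 2 L 1 U))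
          ((((hubbardTorus 2 L 1 U).minEnergyOn
            (szSector (2 * ⌊(1 - 0) * (L : ℝ) ^ 2 / 2⌋₊) 0) : ℝ) : ℂ)) := by
  -- nonzero members of the ground eigenspace are sector ground states
  have hgs : ∀ v ∈ szSector (2 * ⌊(1 - 0) * (L : ℝ) ^ 2 / 2⌋₊) 0 ⊓
        Module.End.eigenspace (Matrix.toLin' (hubbardTorus 2 L 1 U))
          ((((hubbardTorus 2 L 1 U).minEnergyOn
            (szSector (2 * ⌊(1 - 0) * (L : ℝ) ^ 2 / 2⌋₊) 0) : ℝ) : ℂ)), v ≠ 0 →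
      IsGroundStateInSector (hubbardTorus 2 L 1 U) (2 * ⌊(1 - 0) * (L : ℝ) ^ 2 / 2⌋₊) 0 v := by
    intro v hv hv0
    obtain ⟨hvS, hvE⟩ := Submodule.mem_inf.mp hv
    refine ⟨hvS, hv0, ?_⟩
    have h := Module.End.mem_eigenspace_iff.mp hvE
    rwa [Matrix.toLin'_apply] at h
  by_cases hbot : K' = ⊥
  · exact Or.inl hbot
  · right
    obtain ⟨v, hvK, hv0⟩ := (Submodule.ne_bot_iff K').mp hbot
    refine le_antisymm hK' fun w hw => ?_
    by_cases hw0 : w = 0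
    · rw [hw0]; exact K'.zero_mem
    · obtain ⟨a, ha⟩ :=
        groundStates_smul_halfFilling hU L hLe v w (hgs v (hK' hvK) hv0) (hgs w hw hw0)
      rw [ha]; exact K'.smul_mem a hvK

/-- **The BET of line `birth` at `δ := 0`, verbatim** (`stub_countableAccidentalCouplings` of
`Cruxes/AverageToEvery/Lines/birth.lean` specialised to half filling): under (indeed regardless of)
the window hypothesis, with threshold `L₁ = 0` and EMPTY exceptional sets `B L = ∅`, for every even
side and every coupling of the window `(U₁, U₂) ⊂ (0, ∞)` the sector ground eigenspace is irreducible
under the joint commutant of `H`, `N̂`, `S^z`, `Δ_d† Δ_d` — because it has no proper nonzero subspace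
at all (`irreducibleGround_halfFilling`). Lieb, PRL 62 (1989) 1201, Theorem 2.
[cite: LiebPRL1989, Theorem 2] -/
theorem stub_countableAccidentalCouplings_halfFilling :
    ∀ (U₁ U₂ c : ℝ) (L₀ : ℕ), 0 < U₁ → U₁ < U₂ → 0 < c →
      (∀ U ∈ Set.Ioo U₁ U₂, ∀ (L : ℕ) [NeZero L], L₀ ≤ L → Even L →
        c * (L : ℝ) ^ 4 ≤ (((hubbardTorus 2 L 1 U).toBlock
          (fun s : Finset (Orb (FermionTorus 2 L)) => s.card = 2 * ⌊(1 - 0) * (L : ℝ) ^ 2 / 2⌋₊ ∧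
            2 * (s.filter fun i => (ofLex i).2 = 0).card = 2 * ⌊(1 - 0) * (L : ℝ) ^ 2 / 2⌋₊)
          (fun s : Finset (Orb (FermionTorus 2 L)) => s.card = 2 * ⌊(1 - 0) * (L : ℝ) ^ 2 / 2⌋₊ ∧
            2 * (s.filter fun i => (ofLex i).2 = 0).card = 2 * ⌊(1 - 0) * (L : ℝ) ^ 2 / 2⌋₊)).groundStateFunctional
          ((((pairField dWaveFormFactor L)ᴴ * pairField dWaveFormFactor L)).toBlock
          (fun s : Finset (Orb (FermionTorus 2 L)) => s.card = 2 * ⌊(1 - 0) * (L : ℝ) ^ 2 / 2⌋₊ ∧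
            2 * (s.filter fun i => (ofLex i).2 = 0).card = 2 * ⌊(1 - 0) * (L : ℝ) ^ 2 / 2⌋₊)
          (fun s : Finset (Orb (FermionTorus 2 L)) => s.card = 2 * ⌊(1 - 0) * (L : ℝ) ^ 2 / 2⌋₊ ∧
            2 * (s.filter fun i => (ofLex i).2 = 0).card = 2 * ⌊(1 - 0) * (L : ℝ) ^ 2 / 2⌋₊))).re) →
      ∃ L₁ : ℕ, ∃ B : ℕ → Set ℝ, (∀ L, (B L).Countable) ∧
        ∀ (L : ℕ) [NeZero L], L₁ ≤ L → Even L → ∀ U ∈ Set.Ioo U₁ U₂, U ∉ B L →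
          ∀ K' : Submodule ℂ (Fock (Orb (FermionTorus 2 L))),
            K' ≤ szSector (2 * ⌊(1 - 0) * (L : ℝ) ^ 2 / 2⌋₊) 0 ⊓
              Module.End.eigenspace (Matrix.toLin' (hubbardTorus 2 L 1 U))
                ((((hubbardTorus 2 L 1 U).minEnergyOn
                  (szSector (2 * ⌊(1 - 0) * (L : ℝ) ^ 2 / 2⌋₊) 0) : ℝ) : ℂ)) →
            (∀ X : Matrix (Finset (Orb (FermionTorus 2 L))) (Finset (Orb (FermionTorus 2 L))) ℂ,
              X * hubbardTorus 2 L 1 U = hubbardTorus 2 L 1 U * X →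
              X * totalNumber = totalNumber * X →
              X * HubbardWave0.spinZ = HubbardWave0.spinZ * X →
              X * ((pairField dWaveFormFactor L)ᴴ * pairField dWaveFormFactor L) =
                (pairField dWaveFormFactor L)ᴴ * pairField dWaveFormFactor L * X →
              ∀ v ∈ K', X *ᵥ v ∈ K') →
            K' = ⊥ ∨
              K' = szSector (2 * ⌊(1 - 0) * (L : ℝ) ^ 2 / 2⌋₊) 0 ⊓
                Module.End.eigenspace (Matrix.toLin' (hubbardTorus 2 L 1 U))
                  ((((hubbardTorus 2 L 1 U).minEnergyOn
                    (szSector (2 * ⌊(1 - 0) * (L : ℝ) ^ 2 / 2⌋₊) 0) : ℝ) : ℂ)) := by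
  intro U₁ U₂ _ _ hU₁ _ _ _
  refine ⟨0, fun _ => ∅, fun _ => Set.countable_empty, ?_⟩
  intro L _ _ hLe U hU _ K' hK' _
  exact irreducibleGround_halfFilling (hU₁.trans hU.1) L hLe K' hK'

/-- **At half filling the every-ground-state upgrade holds at EVERY repulsive coupling.** Fix
`U > 0`, `c > 0`, `L₀`. If for every even side `L ≥ L₀` the tracial ground-state functional of
`hubbardTorus 2 L 1 U` compressed to the `(L², S^z = 0)` occupation block gives the compressed
`Δ_d† Δ_d` a real part `≥ c L⁴` (the crux's window hypothesis read at the single coupling `U`, with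
`δ = 0`), then EVERY admissible sequence of normalised `(L², S^z = 0)`-sector ground states has
`d_{x²-y²}` pair-field long-range order along even sides. Proof: the block average is carried by one
normalised sector ground state (`stub_blockAverageWitness`); by uniqueness
(`groundStates_smul_halfFilling`) every normalised sector ground state is a phase multiple of it and
has the same expectation; `hasLRO_of_forall_groundState_bound` concludes. No genericity, no window.
Lieb, PRL 62 (1989) 1201, Theorem 2; Tasaki (2020) §2.1. [cite: LiebPRL1989, Theorem 2] -/
theorem averageToEvery_pointwise_halfFilling (U c : ℝ) (hU : 0 < U) (hc : 0 < c) (L₀ : ℕ)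
    (hyp : ∀ (L : ℕ) [NeZero L], L₀ ≤ L → Even L →
        c * (L : ℝ) ^ 4 ≤ (((hubbardTorus 2 L 1 U).toBlock
          (fun s : Finset (Orb (FermionTorus 2 L)) => s.card = 2 * ⌊(1 - 0) * (L : ℝ) ^ 2 / 2⌋₊ ∧
            2 * (s.filter fun i => (ofLex i).2 = 0).card = 2 * ⌊(1 - 0) * (L : ℝ) ^ 2 / 2⌋₊)
          (fun s : Finset (Orb (FermionTorus 2 L)) => s.card = 2 * ⌊(1 - 0) * (L : ℝ) ^ 2 / 2⌋₊ ∧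
            2 * (s.filter fun i => (ofLex i).2 = 0).card = 2 * ⌊(1 - 0) * (L : ℝ) ^ 2 / 2⌋₊)).groundStateFunctional
          ((((pairField dWaveFormFactor L)ᴴ * pairField dWaveFormFactor L)).toBlock
          (fun s : Finset (Orb (FermionTorus 2 L)) => s.card = 2 * ⌊(1 - 0) * (L : ℝ) ^ 2 / 2⌋₊ ∧
            2 * (s.filter fun i => (ofLex i).2 = 0).card = 2 * ⌊(1 - 0) * (L : ℝ) ^ 2 / 2⌋₊)
          (fun s : Finset (Orb (FermionTorus 2 L)) => s.card = 2 * ⌊(1 - 0) * (L : ℝ) ^ 2 / 2⌋₊ ∧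
            2 * (s.filter fun i => (ofLex i).2 = 0).card = 2 * ⌊(1 - 0) * (L : ℝ) ^ 2 / 2⌋₊))).re)
    (N : ℕ → ℕ) (ψ : ∀ L, Fock (Orb (FermionTorus 2 L)))
    (hadm : ∀ L, Even L → N L = 2 * ⌊(1 - 0) * (L : ℝ) ^ 2 / 2⌋₊ ∧ star (ψ L) ⬝ᵥ ψ L = 1 ∧
      IsGroundStateInSector (hubbardTorus 2 L 1 U) (N L) 0 (ψ L)) :
    HasLongRangeOrder (fun k => halfOpenBox 2 (2 * k))
      (fun k => torusPullback (pairFieldCorr dWaveFormFactor ψ) (2 * k)) := by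
  refine hasLRO_of_forall_groundState_bound U 0 c hc L₀ ?_ N ψ hadm
  intro L _ hL hLe φ hgs hunit
  -- one normalised sector ground state carrying the block average (block ↔ Fock dictionary)
  obtain ⟨φ₀, hgs₀, hunit₀, hle₀⟩ :=
    stub_blockAverageWitness U c L ⌊(1 - 0) * (L : ℝ) ^ 2 / 2⌋₊ hc (hyp L hL hLe)
  -- uniqueness: `φ` is a phase multiple of `φ₀`
  obtain ⟨a, ha⟩ := groundStates_smul_halfFilling hU L hLe φ₀ φ hgs₀ hgs
  have haa : star a * a = 1 := by
    have h := hunit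
    rw [ha, star_smul, smul_dotProduct, dotProduct_smul, hunit₀, smul_eq_mul, smul_eq_mul,
      mul_one] at h
    exact h
  have hexp : star φ ⬝ᵥ ((pairField dWaveFormFactor L)ᴴ * pairField dWaveFormFactor L) *ᵥ φ =
      star φ₀ ⬝ᵥ ((pairField dWaveFormFactor L)ᴴ * pairField dWaveFormFactor L) *ᵥ φ₀ := by
    rw [ha, star_smul, Matrix.mulVec_smul, smul_dotProduct, dotProduct_smul, smul_smul, haa,
      one_smul]
  rw [hexp]
  exact hle₀

/-- **The crux `AverageToEvery` HOLDS at half filling** (its `δ := 0` instance, verbatim, window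
form): for all `0 < U₁ < U₂`, `c > 0`, `L₀` — if for every `U ∈ (U₁, U₂)` and every even `L ≥ L₀`
the block ground-state average of `Δ_d† Δ_d` in the `(L², S^z = 0)` sector is `≥ c L⁴`, then at
SOME (indeed any; the midpoint is taken) coupling of the window every admissible normalised sector
ground-state sequence has `d_{x²-y²}` pair-field long-range order along even sides
(`averageToEvery_pointwise_halfFilling`). Lieb, PRL 62 (1989) 1201, Theorem 2.
[cite: LiebPRL1989, Theorem 2] -/
theorem averageToEvery_halfFilling :
    ∀ (U₁ U₂ c : ℝ) (L₀ : ℕ), 0 < U₁ → U₁ < U₂ → 0 < c →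
      (∀ U ∈ Set.Ioo U₁ U₂, ∀ (L : ℕ) [NeZero L], L₀ ≤ L → Even L →
        let p : Finset (Orb (FermionTorus 2 L)) → Prop := fun s =>
          s.card = 2 * ⌊(1 - 0) * (L : ℝ) ^ 2 / 2⌋₊ ∧
            2 * (s.filter fun i => (ofLex i).2 = 0).card = 2 * ⌊(1 - 0) * (L : ℝ) ^ 2 / 2⌋₊
        c * (L : ℝ) ^ 4 ≤ (((hubbardTorus 2 L 1 U).toBlock p p).groundStateFunctional
          (((pairField dWaveFormFactor L)ᴴ * pairField dWaveFormFactor L).toBlock p p)).re) →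
      ∃ U ∈ Set.Ioo U₁ U₂, ∀ (N : ℕ → ℕ) (ψ : ∀ L, Fock (Orb (FermionTorus 2 L))),
        (∀ L, Even L → N L = 2 * ⌊(1 - 0) * (L : ℝ) ^ 2 / 2⌋₊ ∧ star (ψ L) ⬝ᵥ ψ L = 1 ∧
          IsGroundStateInSector (hubbardTorus 2 L 1 U) (N L) 0 (ψ L)) →
        HasLongRangeOrder (fun k => halfOpenBox 2 (2 * k))
          (fun k => torusPullback (pairFieldCorr dWaveFormFactor ψ) (2 * k)) := by
  intro U₁ U₂ c L₀ hU₁ hU₁₂ hc hyp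
  refine ⟨(U₁ + U₂) / 2, ⟨by linarith, by linarith⟩, fun N ψ hadm => ?_⟩
  exact averageToEvery_pointwise_halfFilling ((U₁ + U₂) / 2) c (by linarith) hc L₀
    (fun L _ hL hLe => hyp ((U₁ + U₂) / 2) ⟨by linarith, by linarith⟩ L hL hLe) N ψ hadm

/-- **Bookkeeping: the half-filled statement IS the `δ = 0` instance of the crux.** `AverageToEvery`
specialised at `δ := 0` is, word for word, the statement of `averageToEvery_halfFilling` (one-term
proof by application; this certifies that the slice is typed exactly as the crux and records which
instance of the law is now unconditional). [folklore] -/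
theorem averageToEvery_imp_halfFilling
    (h : Summit.HubbardSuperconductivity.HubbardSuperconductivity.Theses.LogColdTorus.AverageToEvery) :
    ∀ (U₁ U₂ c : ℝ) (L₀ : ℕ), 0 < U₁ → U₁ < U₂ → 0 < c →
      (∀ U ∈ Set.Ioo U₁ U₂, ∀ (L : ℕ) [NeZero L], L₀ ≤ L → Even L →
        let p : Finset (Orb (FermionTorus 2 L)) → Prop := fun s =>
          s.card = 2 * ⌊(1 - 0) * (L : ℝ) ^ 2 / 2⌋₊ ∧
            2 * (s.filter fun i => (ofLex i).2 = 0).card = 2 * ⌊(1 - 0) * (L : ℝ) ^ 2 / 2⌋₊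
        c * (L : ℝ) ^ 4 ≤ (((hubbardTorus 2 L 1 U).toBlock p p).groundStateFunctional
          (((pairField dWaveFormFactor L)ᴴ * pairField dWaveFormFactor L).toBlock p p)).re) →
      ∃ U ∈ Set.Ioo U₁ U₂, ∀ (N : ℕ → ℕ) (ψ : ∀ L, Fock (Orb (FermionTorus 2 L))),
        (∀ L, Even L → N L = 2 * ⌊(1 - 0) * (L : ℝ) ^ 2 / 2⌋₊ ∧ star (ψ L) ⬝ᵥ ψ L = 1 ∧
          IsGroundStateInSector (hubbardTorus 2 L 1 U) (N L) 0 (ψ L)) →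
        HasLongRangeOrder (fun k => halfOpenBox 2 (2 * k))
          (fun k => torusPullback (pairFieldCorr dWaveFormFactor ψ) (2 * k)) :=
  h 0

end Summit.HubbardSuperconductivity.HubbardSuperconductivity.Theorems

end
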